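import Literature.Dynamics.SymbolicDynamics.DistortionCompletion
import Literature.Dynamics.SymbolicDynamics.DistortionCurves
import HarnessLib

/-!
# Gluing two completed boxes across a gap of level lines

The `↓`-layer of the gluing construction for the distortion subshift (Gangloff–Sablik Prop. 32,
first case: the second block far above the first). Given admissible `↓`-sets `N₁`, `N₂`
(`IsDeltaSet`), a box `⟦W, E⟧ × ⟦Bo, T⟧` and an offset `u` with `u.2` large, the set
`gapSet N₁ N₂ W E Bo T u k` is the union of the level completion of the box of `N₁`
(`boxCompl`, `DistortionCompletion.lean`), of `k` full horizontal lines of `↓` above it (rows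
`T + L + 3 + 2j`, `L = E - W`), and of the level completion of the box of `N₂` translated by
`u`. It obeys the rules (`isDeltaSet_gapSet`), restricts to `N₁` on the box and to `u + N₂` on
the translated box, and — the point of the lines — **the curve through a cell `(0, ρ₁)` of the
first box and the curve through `u + (0, ρ₂)` differ by an index `V₀ - k`** in the curve
numbering of the skeleton configuration (`gap_main`): each added line is one curve less between
them. This is the adjustable vertical offset of Gangloff–Sablik's proof ("the curve can be
shifted downwards/upwards `k` times"), realised here by whole lines in the gap.

## References

* S. Gangloff, M. Sablik, *Quantified block gluing for multidimensional subshifts of finite type: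
  aperiodicity and entropy*, J. Anal. Math. 144 (2021), §5.4.2, proof of Prop. 32
  (arXiv:1706.01627).
-/

namespace Literature.Dynamics.SymbolicDynamics.Distortion

/-! ### Lines and translates -/

/-- `k` full horizontal lines of `↓`, on rows `h₀, h₀ + 2, …, h₀ + 2(k-1)`. [cite: GangloffSablik2021, §5.4.2 (arXiv numbering)] -/
def lines (h₀ : ℤ) (k : ℕ) : Set (ℤ × ℤ) :=
  {c | ∃ l : ℕ, l < k ∧ c.2 = h₀ + 2 * l}

/-- [folklore] -/
theorem mem_lines {h₀ : ℤ} {k : ℕ} {c : ℤ × ℤ} : c ∈ lines h₀ k ↔ ∃ l : ℕ, l < k ∧ c.2 = h₀ + 2 * l :=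
  Iff.rfl

/-- Lines two rows apart obey the rules. [cite: GangloffSablik2021, §5.4.2 (arXiv numbering)] -/
theorem isDeltaSet_lines (h₀ : ℤ) (k : ℕ) : IsDeltaSet (lines h₀ k) := by
  refine ⟨fun i j h h' => ?_, fun i j h1 h2 => ?_, fun i j h1 h2 => ?_⟩
  · obtain ⟨l, -, hj⟩ := h
    obtain ⟨l', -, hj'⟩ := h'
    simp only at hj hj'
    omega
  · obtain ⟨l, hl, hj⟩ := h1
    exact absurd ⟨l, hl, hj⟩ h2
  · obtain ⟨l, hl, hj⟩ := h1
    exact absurd ⟨l, hl, hj⟩ h2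

/-- [folklore] -/
theorem lines_row_bounds {h₀ : ℤ} {k : ℕ} {c : ℤ × ℤ} (h : c ∈ lines h₀ k) :
    h₀ ≤ c.2 ∧ c.2 + 2 ≤ h₀ + 2 * k := by
  obtain ⟨l, hl, hj⟩ := h
  constructor <;> omega

/-- Translate of a set of cells. [folklore] -/
def shiftSet (u : ℤ × ℤ) (N : Set (ℤ × ℤ)) : Set (ℤ × ℤ) :=
  (fun c => u + c) '' N

/-- [folklore] -/
theorem mem_shiftSet {u : ℤ × ℤ} {N : Set (ℤ × ℤ)} {c : ℤ × ℤ} : c ∈ shiftSet u N ↔ c - u ∈ N := by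
  constructor
  · rintro ⟨d, hd, rfl⟩
    simpa using hd
  · intro h
    exact ⟨c - u, h, by abel⟩

/-- [folklore] -/
theorem mem_shiftSet_mk {u : ℤ × ℤ} {N : Set (ℤ × ℤ)} {i j : ℤ} :
    (i, j) ∈ shiftSet u N ↔ (i - u.1, j - u.2) ∈ N :=
  mem_shiftSet

/-- [folklore] -/
theorem IsDeltaSet.shiftSet {N : Set (ℤ × ℤ)} (hN : IsDeltaSet N) (u : ℤ × ℤ) :
    IsDeltaSet (shiftSet u N) :=
  hN.add u

/-! ### The gap configuration -/

/-- **The gap configuration**: completed box of `N₁`, `k` lines above it, completed box of `N₂`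
translated by `u`. [cite: GangloffSablik2021, §5.4.2 (arXiv numbering), proof of Prop. 32] -/
def gapSet (N₁ N₂ : Set (ℤ × ℤ)) (W E Bo T : ℤ) (u : ℤ × ℤ) (k : ℕ) : Set (ℤ × ℤ) :=
  (boxCompl N₁ W E Bo T ∪ lines (T + (E - W) + 3) k) ∪ shiftSet u (boxCompl N₂ W E Bo T)

section Gap

variable {N₁ N₂ : Set (ℤ × ℤ)} {W E Bo T : ℤ} {u : ℤ × ℤ} {K : ℕ}
  (hN₁ : IsDeltaSet N₁) (hN₂ : IsDeltaSet N₂) (hWE : W ≤ E) (hBT : Bo ≤ T)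
  (hu : T - Bo + 2 * (E - W) + 4 + 2 * K ≤ u.2)

/-- [folklore] -/
theorem mem_gapSet_mk {k : ℕ} {i j : ℤ} : (i, j) ∈ gapSet N₁ N₂ W E Bo T u k ↔
    (i, j) ∈ boxCompl N₁ W E Bo T ∨ (i, j) ∈ lines (T + (E - W) + 3) k ∨
      (i - u.1, j - u.2) ∈ boxCompl N₂ W E Bo T := by
  simp only [gapSet, Set.mem_union, mem_shiftSet_mk, or_assoc]

include hWE hBT hu in
/-- Below the lines the gap configuration is the completed first box.
[cite: GangloffSablik2021, §5.4.2 (arXiv numbering)] -/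
theorem mem_gapSet_low {k : ℕ} {i j : ℤ} (hj : j ≤ T + (E - W) + 2) :
    (i, j) ∈ gapSet N₁ N₂ W E Bo T u k ↔ (i, j) ∈ boxCompl N₁ W E Bo T := by
  rw [mem_gapSet_mk]
  constructor
  · rintro (h | h | h)
    · exact h
    · have := lines_row_bounds h; simp only at this; omega
    · have := boxCompl_row_bounds hWE hBT h; omega
  · exact fun h => Or.inl h

include hWE hBT in
/-- Above the lines it is the translated completed second box. [cite: GangloffSablik2021, §5.4.2 (arXiv numbering)] -/
theorem mem_gapSet_high {k : ℕ} (hk : k ≤ K) {i j : ℤ} (hj : T + (E - W) + 2 + 2 * K ≤ j) :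
    (i, j) ∈ gapSet N₁ N₂ W E Bo T u k ↔ (i - u.1, j - u.2) ∈ boxCompl N₂ W E Bo T := by
  rw [mem_gapSet_mk]
  constructor
  · rintro (h | h | h)
    · have := boxCompl_row_bounds hWE hBT h; omega
    · have := lines_row_bounds h; simp only at this; omega
    · exact h
  · exact fun h => Or.inr (Or.inr h)

include hWE hBT in
/-- In between there are only the lines. [cite: GangloffSablik2021, §5.4.2 (arXiv numbering)] -/
theorem mem_gapSet_mid {k : ℕ} {i j : ℤ} (hj1 : T + (E - W) + 2 < j)
    (hj2 : j < u.2 + Bo - 1 - (E - W)) :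
    (i, j) ∈ gapSet N₁ N₂ W E Bo T u k ↔ ∃ l : ℕ, l < k ∧ j = T + (E - W) + 3 + 2 * l := by
  rw [mem_gapSet_mk]
  constructor
  · rintro (h | h | h)
    · have := boxCompl_row_bounds hWE hBT h; omega
    · exact h
    · have := boxCompl_row_bounds hWE hBT h; omega
  · exact fun h => Or.inr (Or.inl h)

include hN₁ hN₂ hWE hBT hu in
/-- **The gap configuration obeys the rules.** [cite: GangloffSablik2021, §5.4.2 (arXiv numbering), proof of Prop. 32] -/
theorem isDeltaSet_gapSet {k : ℕ} (hk : k ≤ K) : IsDeltaSet (gapSet N₁ N₂ W E Bo T u k) := by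
  apply IsDeltaSet.union (IsDeltaSet.union (hN₁.boxCompl hWE hBT) (isDeltaSet_lines _ _) ?_ ?_)
    ((hN₂.boxCompl hWE hBT).shiftSet u)
  · rintro i j (h | h) h'
    · have h1 := boxCompl_row_bounds hWE hBT h
      have h2 := boxCompl_row_bounds hWE hBT (mem_shiftSet_mk.mp h')
      omega
    · have h1 := lines_row_bounds h
      have h2 := boxCompl_row_bounds hWE hBT (mem_shiftSet_mk.mp h')
      simp only at h1; omega
  · rintro i j h (h' | h')
    · have h1 := boxCompl_row_bounds hWE hBT (mem_shiftSet_mk.mp h)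
      have h2 := boxCompl_row_bounds hWE hBT h'
      omega
    · have h1 := boxCompl_row_bounds hWE hBT (mem_shiftSet_mk.mp h)
      have h2 := lines_row_bounds h'
      simp only at h2; omega
  · intro i j h h'
    have h1 := boxCompl_row_bounds hWE hBT h
    have h2 := lines_row_bounds h'
    simp only at h2; omega
  · intro i j h h'
    have h1 := lines_row_bounds h
    have h2 := boxCompl_row_bounds hWE hBT h'
    simp only at h1; omega

include hWE hBT hu in
/-- On the first box the gap configuration is `N₁`. [cite: GangloffSablik2021, §5.4.2 (arXiv numbering)] -/
theorem mem_gapSet_box₁ {k : ℕ} {i j : ℤ} (h1 : W ≤ i) (h2 : i ≤ E) (h3 : Bo ≤ j) (h4 : j ≤ T) :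
    (i, j) ∈ gapSet N₁ N₂ W E Bo T u k ↔ (i, j) ∈ N₁ := by
  rw [mem_gapSet_low hWE hBT hu (by omega), mem_boxCompl_box h1 h2 h3 h4]

include hWE hBT hu in
/-- On the translated box it is `u + N₂`. [cite: GangloffSablik2021, §5.4.2 (arXiv numbering)] -/
theorem mem_gapSet_box₂ {k : ℕ} (hk : k ≤ K) {i j : ℤ} (h1 : W ≤ i - u.1) (h2 : i - u.1 ≤ E)
    (h3 : Bo ≤ j - u.2) (h4 : j - u.2 ≤ T) :
    (i, j) ∈ gapSet N₁ N₂ W E Bo T u k ↔ (i - u.1, j - u.2) ∈ N₂ := by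
  rw [mem_gapSet_high hWE hBT hk (by omega), mem_boxCompl_box h1 h2 h3 h4]

end Gap

/-! ### The index offset between the two boxes -/

section Main

variable {N₁ N₂ : Set (ℤ × ℤ)} {W E Bo T : ℤ} {u : ℤ × ℤ} {K : ℕ} {ρ₁ ρ₂ : ℤ}
  (hN₁ : IsDeltaSet N₁) (hN₂ : IsDeltaSet N₂) (hW : W ≤ 0) (hE : 0 ≤ E) (hBT : Bo ≤ T)
  (hu : T - Bo + 2 * (E - W) + 4 + 2 * K ≤ u.2)
  (hρ₁ : Bo ≤ ρ₁) (hρ₁' : ρ₁ ≤ T) (hρ₂ : Bo ≤ ρ₂) (hρ₂' : ρ₂ ≤ T)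

/-- Group-theoretic rearrangement used at the end. [folklore] -/
theorem succ_nxt_rearrange {z : ℤ × ℤ → Option Unit} (hz : IsDelta z) (c₁ c₂ : RC z) (a b v : ℤ)
    (h : (nxtPerm hz ^ v) ((succPerm hz ^ a) c₁) = (succPerm hz ^ b) c₂) :
    (succPerm hz ^ (a - b)) ((nxtPerm hz ^ v) c₁) = c₂ := by
  have hc : Commute (succPerm hz ^ a) (nxtPerm hz ^ v) := (commute_succPerm_nxtPerm hz).zpow_zpow a v
  have h' : (succPerm hz ^ a) ((nxtPerm hz ^ v) c₁) = (succPerm hz ^ b) c₂ := by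
    rw [← Equiv.Perm.mul_apply, hc.eq, Equiv.Perm.mul_apply, h]
  rw [show a - b = -b + a by ring, zpow_add, Equiv.Perm.mul_apply, h', ← Equiv.Perm.mul_apply,
    ← zpow_add, neg_add_cancel, zpow_zero, Equiv.Perm.one_apply]

include hN₁ hN₂ hW hE hBT hu hρ₁ hρ₁' hρ₂ hρ₂' in
/-- **The index offset across the gap.** In the skeleton of the gap configuration with `k ≤ K`
lines, the `→`-cells `c₁ = (0, ρ₁)` (first box) and `c₂ = u + (0, ρ₂)` (second box) satisfy
`c₂ = succ^{u.1} (nxt^{V₀ - k} (c₁))` for one `V₀` independent of `k`: following both curves to a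
common column right of both boxes, they are separated there by `↓`-rows of the two completions
(independent of `k`, by locality) and by the `k` lines.
[cite: GangloffSablik2021, §5.4.2 (arXiv numbering), proof of Prop. 32] -/
theorem gap_main (hn₁ : ((0 : ℤ), ρ₁) ∉ N₁) (hn₂ : ((0 : ℤ), ρ₂) ∉ N₂) : ∃ V₀ : ℤ,
    u.2 + Bo - T - 2 * (E - W) - 4 ≤ V₀ ∧ ∀ k : ℕ, k ≤ K →
    ∀ (hz : IsDelta (skel (gapSet N₁ N₂ W E Bo T u k)))
      (h₁ : skel (gapSet N₁ N₂ W E Bo T u k) (0, ρ₁) ≠ none)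
      (h₂ : skel (gapSet N₁ N₂ W E Bo T u k) (u.1, u.2 + ρ₂) ≠ none),
      (succPerm hz ^ u.1) ((nxtPerm hz ^ (V₀ - k)) ⟨(0, ρ₁), h₁⟩) = ⟨(u.1, u.2 + ρ₂), h₂⟩ := by
  have hWE : W ≤ E := by omega
  -- the configuration without lines
  set z0 := skel (gapSet N₁ N₂ W E Bo T u 0) with hz0_def
  have hz0 : IsDelta z0 := isDelta_skel_iff.mpr (isDeltaSet_gapSet hN₁ hN₂ hWE hBT hu (Nat.zero_le K))
  have hc₁0 : z0 (0, ρ₁) ≠ none := fun h =>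
    hn₁ ((mem_gapSet_box₁ hWE hBT hu hW hE hρ₁ hρ₁').mp (skel_eq_none_iff.mp h))
  have hc₂0 : z0 (u.1, u.2 + ρ₂) ≠ none := by
    intro h
    have := (mem_gapSet_high hWE hBT (Nat.zero_le K) (by omega)).mp (skel_eq_none_iff.mp h)
    rw [mem_boxCompl_box (by omega) (by omega) (by omega) (by omega)] at this
    exact hn₂ (by simpa using this)
  set c₁0 : RC z0 := ⟨(0, ρ₁), hc₁0⟩ with hc₁0_def
  set c₂0 : RC z0 := ⟨(u.1, u.2 + ρ₂), hc₂0⟩ with hc₂0_def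
  -- numbers of steps
  obtain ⟨m₁, hm₁⟩ : ∃ m₁ : ℕ, (m₁ : ℤ) = E + 1 := ⟨(E + 1).toNat, by omega⟩
  set M := max 0 u.1 with hM_def
  have hM0 : 0 ≤ M := le_max_left _ _
  have hMu : u.1 ≤ M := le_max_right _ _
  obtain ⟨s₁, hs₁⟩ : ∃ s₁ : ℕ, (s₁ : ℤ) = M + 1 := ⟨(M + 1).toNat, by omega⟩
  obtain ⟨s₂, hs₂⟩ : ∃ s₂ : ℕ, (s₂ : ℤ) = M - u.1 + 1 := ⟨(M - u.1 + 1).toNat, by omega⟩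
  set t₀ := M + E + 2 with ht₀_def
  -- exit rows of the two curves (computed without lines)
  obtain ⟨e₁, he₁⟩ : ∃ e₁ : ℤ, ((succPerm hz0 ^ m₁) c₁0).1 = (E + 1, e₁) :=
    ⟨_, Prod.ext (by rw [(succPerm_pow_row_bounds hz0 c₁0 m₁).1, hm₁]; simp [hc₁0_def]) rfl⟩
  have he₁b : ρ₁ - (E + 1) ≤ e₁ ∧ e₁ ≤ ρ₁ := by
    have h := succPerm_pow_row_bounds hz0 c₁0 m₁
    rw [he₁] at h
    simp only [hc₁0_def] at h
    constructor <;> omega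
  obtain ⟨f₂, hf₂⟩ : ∃ f₂ : ℤ, ((succPerm hz0 ^ m₁) c₂0).1 = (u.1 + E + 1, f₂) :=
    ⟨_, Prod.ext (by rw [(succPerm_pow_row_bounds hz0 c₂0 m₁).1, hm₁]; simp [hc₂0_def]; ring) rfl⟩
  have hf₂b : u.2 + ρ₂ - (E + 1) ≤ f₂ ∧ f₂ ≤ u.2 + ρ₂ := by
    have h := succPerm_pow_row_bounds hz0 c₂0 m₁
    rw [hf₂] at h
    simp only [hc₂0_def] at h
    constructor <;> omega
  -- the `k`-independent parts of the count
  set M₁ := T + (E - W) + 2 with hM₁_def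
  set M₂ := u.2 + Bo - (E - W) - 2 with hM₂_def
  set A := noneCount z0 t₀ e₁ M₁ with hA_def
  set B := noneCount z0 t₀ M₂ f₂ with hB_def
  have hA : (A : ℤ) ≤ max 0 (M₁ - e₁ - 1) := noneCount_le
  have hB : (B : ℤ) ≤ max 0 (f₂ - M₂ - 1) := noneCount_le
  refine ⟨f₂ - e₁ - A - B, ?_, fun k hk hz h₁ h₂ => ?_⟩
  · have h1 : max 0 (M₁ - e₁ - 1) = M₁ - e₁ - 1 := max_eq_right (by omega)
    have h2 : max 0 (f₂ - M₂ - 1) = f₂ - M₂ - 1 := max_eq_right (by omega)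
    omega
  set zk := skel (gapSet N₁ N₂ W E Bo T u k) with hzk_def
  have hmemk : ∀ c : ℤ × ℤ, zk c = none ↔ c ∈ gapSet N₁ N₂ W E Bo T u k := fun c => skel_eq_none_iff
  have hmem0 : ∀ c : ℤ × ℤ, z0 c = none ↔ c ∈ gapSet N₁ N₂ W E Bo T u 0 := fun c => skel_eq_none_iff
  -- agreement below and above the lines
  have hlow : ∀ i j : ℤ, j ≤ M₁ → (z0 (i, j) = none ↔ zk (i, j) = none) := by
    intro i j hj
    rw [hmemk, hmem0, mem_gapSet_low hWE hBT hu hj, mem_gapSet_low hWE hBT hu hj]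
  have hhigh : ∀ i j : ℤ, T + (E - W) + 2 + 2 * K ≤ j → (z0 (i, j) = none ↔ zk (i, j) = none) := by
    intro i j hj
    rw [hmemk, hmem0, mem_gapSet_high hWE hBT (Nat.zero_le K) hj, mem_gapSet_high hWE hBT hk hj]
  set c₁ : RC zk := ⟨(0, ρ₁), h₁⟩ with hc₁_def
  set c₂ : RC zk := ⟨(u.1, u.2 + ρ₂), h₂⟩ with hc₂_def
  -- (1) the first curve reaches column `E + 1` at row `e₁` …
  have hp₁ : ((succPerm hz ^ m₁) c₁).1 = (E + 1, e₁) := by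
    rw [← he₁]
    refine succPerm_pow_local hz0 hz c₁0 c₁ rfl m₁ (fun t j _ _ _ h4 => hlow t j ?_) m₁ le_rfl
    simp only [hc₁0_def] at h4
    omega
  -- … and then runs level to column `t₀`
  have hq₁ : ((succPerm hz ^ (s₁ + m₁)) c₁).1 = (t₀, e₁) := by
    rw [pow_add, Equiv.Perm.mul_apply]
    have hlev := succPerm_pow_level hz ((succPerm hz ^ m₁) c₁) s₁ ?_ s₁ le_rfl
    · rw [hlev, hp₁]; simp only; rw [hs₁, ht₀_def]; ring
    intro t ht1 ht2 hn
    rw [hp₁] at ht1 ht2 hn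
    simp only at ht1 ht2 hn
    have hsome : zk (E + 1, e₁) ≠ none := by have := ((succPerm hz ^ m₁) c₁).2; rwa [hp₁] at this
    rw [Ne, hmemk, mem_gapSet_low hWE hBT hu (by omega), mem_boxCompl_of_gt hWE (by omega)] at hsome
    rw [hmemk, mem_gapSet_low hWE hBT hu (by omega), mem_boxCompl_of_gt hWE (by omega)] at hn
    exact hsome hn
  -- (2) the second curve reaches column `u.1 + E + 1` at row `f₂` …
  have hp₂ : ((succPerm hz ^ m₁) c₂).1 = (u.1 + E + 1, f₂) := by
    rw [← hf₂]
    refine succPerm_pow_local hz0 hz c₂0 c₂ rfl m₁ (fun t j _ _ h3 _ => hhigh t j ?_) m₁ le_rfl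
    simp only [hc₂0_def] at h3
    omega
  -- … and then runs level to column `t₀`
  have hq₂ : ((succPerm hz ^ (s₂ + m₁)) c₂).1 = (t₀, f₂) := by
    rw [pow_add, Equiv.Perm.mul_apply]
    have hlev := succPerm_pow_level hz ((succPerm hz ^ m₁) c₂) s₂ ?_ s₂ le_rfl
    · rw [hlev, hp₂]; simp only; rw [hs₂, ht₀_def]; ring
    intro t ht1 ht2 hn
    rw [hp₂] at ht1 ht2 hn
    simp only at ht1 ht2 hn
    have hsome : zk (u.1 + E + 1, f₂) ≠ none := by have := ((succPerm hz ^ m₁) c₂).2; rwa [hp₂] at this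
    rw [Ne, hmemk, mem_gapSet_high hWE hBT hk (by omega), mem_boxCompl_of_gt hWE (by omega)] at hsome
    rw [hmemk, mem_gapSet_high hWE hBT hk (by omega), mem_boxCompl_of_gt hWE (by omega)] at hn
    exact hsome hn
  -- (3) counting the `↓` of column `t₀` between the two curves
  set q₁ := (succPerm hz ^ (s₁ + m₁)) c₁ with hq₁_def
  set q₂ := (succPerm hz ^ (s₂ + m₁)) c₂ with hq₂_def
  obtain ⟨b, hb, hcount⟩ := nxtPerm_pow_eq_of_count hz q₁ q₂ (by rw [hq₁, hq₂])
    (by rw [hq₁, hq₂]; simp only; omega)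
  rw [hq₁, hq₂] at hcount
  simp only at hcount
  have hsomeM₁ : zk (t₀, M₁) ≠ none := by
    rw [Ne, hmemk, mem_gapSet_low hWE hBT hu le_rfl]
    intro h
    have := boxCompl_row_bounds hWE hBT h
    omega
  have hsomeM₂ : zk (t₀, M₂) ≠ none := by
    rw [Ne, hmemk, mem_gapSet_high hWE hBT hk (by omega)]
    intro h
    have := boxCompl_row_bounds hWE hBT h
    omega
  have hT1 : noneCount zk t₀ e₁ M₁ = A :=
    noneCount_congr fun j _ hj2 => (hlow t₀ j hj2.le).symm
  have hT2 : noneCount zk t₀ M₁ M₂ = k := by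
    refine noneCount_eq_of_progression (h₀ := T + (E - W) + 3) (by omega) (by omega) fun j hj1 hj2 => ?_
    rw [hmemk, mem_gapSet_mid hWE hBT (by omega) (by omega)]
  have hT3 : noneCount zk t₀ M₂ f₂ = B :=
    noneCount_congr fun j hj1 _ => (hhigh t₀ j (by omega)).symm
  have hsplit : noneCount zk t₀ e₁ f₂ = A + k + B := by
    rw [noneCount_split (a := e₁) (b := f₂) (by omega) (by omega) hsomeM₁,
      noneCount_split (a := M₁) (b := f₂) (by omega) (by omega) hsomeM₂, hT1, hT2, hT3, add_assoc]
  rw [hsplit] at hcount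
  push_cast at hcount
  have hbV : (b : ℤ) = f₂ - e₁ - A - B - k := by omega
  -- (4) rearrange
  have hb' : (nxtPerm hz ^ (b : ℤ)) ((succPerm hz ^ ((s₁ + m₁ : ℕ) : ℤ)) c₁) =
      (succPerm hz ^ ((s₂ + m₁ : ℕ) : ℤ)) c₂ := by
    rw [zpow_natCast, zpow_natCast, zpow_natCast]
    exact hb
  have := succ_nxt_rearrange hz c₁ c₂ _ _ _ hb'
  rwa [show ((s₁ + m₁ : ℕ) : ℤ) - ((s₂ + m₁ : ℕ) : ℤ) = u.1 by push_cast; omega, hbV] at this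

end Main

end Literature.Dynamics.SymbolicDynamics.Distortion
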